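import Mathlib
import Summits.ResolutionOfSingularities.ResolutionOfSingularities.Theorems.RadicialJungCleanModelsLens5TFramePMon
import Literature.FieldTheory.Separability.PDegreeSeparablyGenerated
import Literature.FieldTheory.Separability.PIndependentDerivations
import HarnessLib

/-!
# Route `RadicialJung`, crux `CleanModels` (stmt-15917): T⁗ port part 11/13 — `Lens5_PDegreeCount.lean` §B/§A: the `p`-degree of purely transcendental and of finite extensions (source PDegreeCount :109–382)

PORT (line lead `res-B-lead-1` g8, for Sketch rev 32) of res-B-lens-5's crux workfiles `Cruxes/DescentPerfectToAll/Lens5_TFrame.lean` rev 4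
(crux ae884a356928; author res-B-lens-5 g15; `lean check` rc 0 · 0 sorries · 0 warnings; crit-1 TRIAGE-146/150 PASS) and
`Cruxes/DescentPerfectToAll/Lens5_PDegreeCount.lean` rev 3 (crux 100289d6413b; TRIAGE-151 PASS): THEOREMS T⁗ / T⁗′ / T⁗″ / T⁗‴ — the slice
{`[Γ:pΓ] = p²`, `k` of FINITE `p`-rank `r`, `[κ_v : κ_v^p] = p^r`} of the research stub `stub_cleanLU3DefectNonDiscrete` (valuations of MINIMAL
Frobenius defect `d(K|K^p, v) = p`, ANY such ground field: no perfectness, no separability of `K/k` or `κ_v/k`), modulo F-02 `CossartPiltant2019` and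
F-32 (`hEmb`) only.  The port is split into def-free modules `…Lens5TFrame{RG,IR,Graded,Port2,Port4Core,Layer,Layer2,Port4,Composition,PMon,PDegreeA,PDegreeB,PDegreeC}`
over ONE currency module `…Lens5TFrameCurrency` (the authors' `def`s, verbatim); declarations VERBATIM, namespace
`Summit.ResolutionOfSingularities.ResolutionOfSingularities.Theorems.RadicialJungCleanModels.Lens5TFrame` (the authors' §A copy of
`Lens5_PDegreeSep` and the constant-frame corollaries `cleanLU3DefectPRankTwoSepFin_of_frame` / `…SepFin_of_cossartPiltant2019'` are not ported).
OURS · counted 0 · nothing here proves resolution in characteristic `p`.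


-/

set_option linter.dupNamespace false -- mandated namespace of this single-conjunct summit

noncomputable section

section

open IsLocalRing IntermediateField Module MvPolynomial
open Literature.AlgebraicGeometry.Resolution
open Summit.ResolutionOfSingularities.ResolutionOfSingularities.Theorems.RadicialJung.CleanModels
open Summit.ResolutionOfSingularities.ResolutionOfSingularities.Theorems.RadicialJung.CleanModels.Lens5
open Summit.ResolutionOfSingularities.ResolutionOfSingularities.Theorems.RadicialJung.CleanModels.Lens5.PRankTwoCurrency
open Summit.ResolutionOfSingularities.ResolutionOfSingularities.Theorems.RadicialJung.CleanModels.Lens5.PRankTwoAssembly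
open Summit.ResolutionOfSingularities.ResolutionOfSingularities.Theorems.RadicialJungCleanModels.Lens5RegularityCriterion
open Summit.ResolutionOfSingularities.ResolutionOfSingularities.Theorems.RadicialJungCleanModels.Lens5ChartSurjection

namespace Summit.ResolutionOfSingularities.ResolutionOfSingularities.Theorems.RadicialJungCleanModels.Lens5TFrame

/-! ## §B The `p`-degree of a purely transcendental extension over a ground field with a finite `p`-basis -/

section PurelyTranscendental

variable {k : Type} [Field k] {F : Type} [Field F] [Algebra k F] (p : ℕ) [Fact p.Prime] [CharP F p]

/-- A `ℤ`-derivation killing a set kills the subfield `F^p(t)` it generates together with the `p`-th powers. [folklore] -/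
theorem derivation_eq_zero_of_mem_adjoin_frobenius (D : Derivation ℤ F F) {t : Set F}
    (ht : ∀ b ∈ t, D b = 0) {x : F} (hx : x ∈ adjoin (frobenius F p).fieldRange t) : D x = 0 := by
  have hx' : x ∈ Subfield.closure (Set.range (algebraMap (frobenius F p).fieldRange F) ∪ t) := by
    rwa [← adjoin_toSubfield]
  have h := Literature.FieldTheory.Separability.Derivation.eqOn_subfieldClosure (D₁ := D) (D₂ := 0)
    (s := Set.range (algebraMap (frobenius F p).fieldRange F) ∪ t) ?_ hx'
  · simpa using h
  · rintro y (⟨c, rfl⟩ | hy)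
    · obtain ⟨z, hz⟩ := RingHom.mem_fieldRange.mp c.2
      change D (c : F) = (0 : Derivation ℤ F F) _
      rw [Derivation.zero_apply, ← hz, frobenius_def]
      exact Literature.FieldTheory.Separability.Derivation.apply_pow_char (p := p) D z
    · rw [Derivation.zero_apply]
      exact ht y hy

/-- **Dual derivations ⇒ `p`-independence over `F^p`**: a finite set carrying `ℤ`-derivations `δ_a` with `δ_a(a) = 1`, `δ_a(b) = 0`
(`b ≠ a` in the set) is `p`-independent over `F^p` (exchange lemma, induction on the set). [cite: Matsumura1987, §26 p. 202] -/
theorem isPIndependent_of_dual (t : Finset F) (δ : F → Derivation ℤ F F)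
    (hδ : ∀ a ∈ t, δ a a = 1 ∧ ∀ b ∈ t, b ≠ a → δ a b = 0) :
    Literature.AlgebraicGeometry.Resolution.IsPIndependent (F := (frobenius F p).fieldRange) p (t : Set F) := by
  classical
  suffices h : ∀ u : Finset F, u ⊆ t →
      Literature.AlgebraicGeometry.Resolution.IsPIndependent (F := (frobenius F p).fieldRange) p (u : Set F) from
    h t subset_rfl
  intro u
  induction u using Finset.induction_on with
  | empty =>
    intro _
    rw [Finset.coe_empty]
    exact Literature.AlgebraicGeometry.Resolution.isPIndependent_empty _ p
  | insert a u hau ih =>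
    intro hut
    have hut' : u ⊆ t := fun x hx => hut (Finset.mem_insert_of_mem hx)
    have hat : a ∈ t := hut (Finset.mem_insert_self a u)
    rw [Finset.coe_insert]
    refine Literature.AlgebraicGeometry.Resolution.isPIndependent_insert (ih hut') ?_
      ⟨⟨a ^ p, RingHom.mem_fieldRange.mpr ⟨a, frobenius_def ..⟩⟩, rfl⟩
    intro hmem
    have hDu : ∀ b ∈ (u : Set F), δ a b = 0 := fun b hb =>
      (hδ a hat).2 b (hut' hb) (fun h => hau (h ▸ (Finset.mem_coe.mp hb)))
    have := derivation_eq_zero_of_mem_adjoin_frobenius p (δ a) hDu hmem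
    rw [(hδ a hat).1] at this
    exact one_ne_zero this

/-- **`[F : F^p] = p^{r + #s}` for `F = k(s)` purely transcendental over a ground field `k` with a `p`-basis of `r` elements**
(`β` `p`-spans `k` through its `p`-monomials and is `p`-free).  The `r + #s` elements `β ∪ s` form a `p`-basis of `F`: they `p`-generate
(`k = k^p[β] ⊆ F^p(β)`), and they are `p`-independent by DUAL DERIVATIONS — `∂/∂s_a` (the `k`-derivations of `k(s)`), and the derivations
`Δ_j` of `k` dual to `β` (Matsumura §26) extended to `k(s)` along the formally smooth `k → k[X_s] → k(s)` and corrected by `Σ_a Δ_j(s_a) ∂/∂s_a`.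
Degree of imperfection is additive: `+1` per transcendental (Becker–MacLane 1940). [cite: Matsumura1987, §26 p. 202, Thm. 26.5, Thm. 26.10] -/
theorem finrank_frobenius_purelyTranscendental [CharP k p] (s : Finset F) (hs : AlgebraicIndependent k ((↑) : s → F))
    (htop : adjoin k (s : Set F) = ⊤)
    {r : ℕ} (β : Fin r → k) (hβspan : IsPSpanningFamily p (pMonomial p β))
    (hβfree : ∀ i, β i ∉ Subfield.closure (Set.range (fun x : k => x ^ p) ∪ β '' ({i}ᶜ : Set (Fin r)))) :
    finrank (frobenius F p).fieldRange F = p ^ (r + s.card) := by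
  classical
  have hp : p.Prime := Fact.out
  haveI : ExpChar F p := ExpChar.prime hp
  set Fp := (frobenius F p).fieldRange with hFpdef
  -- ### the `k`-derivations `∂_a` dual to `s` (`k(s)/k(s)` is separable)
  have hsep : Algebra.IsSeparable (adjoin k (s : Set F)) F := by
    rw [htop]
    exact ⟨fun x => isSeparable_algebraMap (⟨x, trivial⟩ : (⊤ : IntermediateField k F))⟩
  have hds := fun a : s => Literature.FieldTheory.Separability.exists_derivation_dual s hs hsep a
  choose ds hds1 hds0 using hds
  -- ### `k → F` is formally smooth (`F ≅ Frac k[X_s]`)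
  let A := MvPolynomial (s : Type) k
  let L₀ : IntermediateField k F := adjoin k (s : Set F)
  have hrange : Set.range ((↑) : s → F) = (s : Set F) := Subtype.range_coe
  let e : FractionRing A ≃ₐ[k] L₀ := hs.aevalEquivField.trans (equivOfEq (by rw [hrange]))
  letI algAL : Algebra A L₀ := ((e : FractionRing A →+* L₀).comp (algebraMap A (FractionRing A))).toAlgebra
  have halgAL : ∀ a : A, algebraMap A L₀ a = e (algebraMap A (FractionRing A) a) := fun _ => rfl
  let e' : FractionRing A ≃ₐ[A] L₀ := AlgEquiv.ofRingEquiv (f := (e : FractionRing A ≃+* L₀)) (fun a => (halgAL a).symm)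
  haveI : IsFractionRing A L₀ := IsLocalization.isLocalization_of_algEquiv (nonZeroDivisors A) e'
  haveI : Algebra.FormallySmooth A L₀ := Algebra.FormallySmooth.of_isLocalization (nonZeroDivisors A)
  haveI : IsScalarTower k A L₀ := IsScalarTower.of_algebraMap_eq fun c => by
    rw [halgAL, ← IsScalarTower.algebraMap_apply k A (FractionRing A) c, AlgEquiv.commutes]
  haveI : Algebra.FormallySmooth k L₀ := Algebra.FormallySmooth.comp k A L₀
  let etop : L₀ ≃ₐ[k] F := (equivOfEq htop).trans topEquiv
  haveI : Algebra.FormallySmooth k F := Algebra.FormallySmooth.of_equiv etop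
  -- ### the derivations `Δ_j` dual to `β`, extended to `F` and corrected
  have hΔ : ∀ j : Fin r, ∃ D : Derivation ℤ F F, D (algebraMap k F (β j)) = 1 ∧
      (∀ l : Fin r, l ≠ j → D (algebraMap k F (β l)) = 0) ∧ ∀ a : s, D (a : F) = 0 := by
    intro j
    haveI : CharP k p := inferInstance
    obtain ⟨D₀, hD₀1, hD₀0⟩ := Literature.FieldTheory.Separability.exists_derivation_eq_one_eqOn_zero p
      (Subfield.closure (Set.range (fun x : k => x ^ p) ∪ β '' ({j}ᶜ : Set (Fin r))))
      (fun x => Subfield.subset_closure (Or.inl ⟨x, rfl⟩)) (hβfree j)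
    let d : Derivation ℤ k F := (Algebra.linearMap k F).compDer D₀
    have hd : ∀ c : k, d c = algebraMap k F (D₀ c) := fun _ => rfl
    obtain ⟨D₁, hD₁⟩ := Literature.NumberTheory.Transcendental.Derivation.exists_extension_of_formallySmooth
      (R := ℤ) (S := k) (T := F) (M := F) d
    let D : Derivation ℤ F F := D₁ - ∑ a : s, (D₁ (a : F)) • (ds a).restrictScalars ℤ
    have hDapply : ∀ x : F, D x = D₁ x - ∑ a : s, D₁ (a : F) * ds a x := by
      intro x
      simp only [D, Derivation.sub_apply, Literature.FieldTheory.Separability.Derivation.finset_sum_apply,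
        Derivation.smul_apply, Derivation.restrictScalars_apply, smul_eq_mul]
    refine ⟨D, ?_, fun l hl => ?_, fun a => ?_⟩
    · rw [hDapply, hD₁, hd, hD₀1, map_one, Finset.sum_eq_zero fun a _ => by rw [Derivation.map_algebraMap, mul_zero], sub_zero]
    · rw [hDapply, hD₁, hd, hD₀0 _ (Subfield.subset_closure (Or.inr ⟨l, hl, rfl⟩)), map_zero,
        Finset.sum_eq_zero fun a _ => by rw [Derivation.map_algebraMap, mul_zero], sub_zero]
    · rw [hDapply, Finset.sum_eq_single a, hds1, mul_one, sub_self]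
      · intro b _ hba; rw [hds0 b a hba.symm, mul_zero]
      · intro h; exact absurd (Finset.mem_univ a) h
  choose Δ hΔ1 hΔ0 hΔs using hΔ
  -- ### the images of `β` are off `s` and pairwise distinct
  have hβs : ∀ j, algebraMap k F (β j) ∉ s := by
    intro j hj
    have h1 := hds1 ⟨_, hj⟩
    rw [Derivation.map_algebraMap] at h1
    exact zero_ne_one h1
  have hβinj : Function.Injective fun j => algebraMap k F (β j) := by
    intro j l hjl
    by_contra hne
    have h0 := hΔ0 l j hne
    rw [show algebraMap k F (β j) = algebraMap k F (β l) from hjl, hΔ1 l] at h0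
    exact one_ne_zero h0
  -- ### the `p`-basis `t := s ∪ β`
  set tβ : Finset F := Finset.univ.image fun j => algebraMap k F (β j) with htβ
  set t : Finset F := s ∪ tβ with htdef
  have hdisj : Disjoint s tβ := by
    rw [Finset.disjoint_right]
    intro x hx
    obtain ⟨j, _, rfl⟩ := Finset.mem_image.mp hx
    exact hβs j
  have hcard : t.card = r + s.card := by
    rw [htdef, Finset.card_union_of_disjoint hdisj, htβ, Finset.card_image_of_injective _ hβinj, Finset.card_univ,
      Fintype.card_fin, add_comm]
  -- dual derivations on `t`
  let δ : F → Derivation ℤ F F := fun x =>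
    if hx : x ∈ s then (ds ⟨x, hx⟩).restrictScalars ℤ
    else if hj : ∃ j, algebraMap k F (β j) = x then Δ hj.choose else 0
  have hδ : ∀ a ∈ t, δ a a = 1 ∧ ∀ b ∈ t, b ≠ a → δ a b = 0 := by
    intro a ha
    rcases Finset.mem_union.mp ha with has | hat
    · refine ⟨by simp only [δ, dif_pos has, Derivation.restrictScalars_apply]; exact hds1 ⟨a, has⟩, fun b hb hba => ?_⟩
      simp only [δ, dif_pos has, Derivation.restrictScalars_apply]
      rcases Finset.mem_union.mp hb with hbs | hbt
      · exact hds0 ⟨a, has⟩ ⟨b, hbs⟩ (fun h => hba (congrArg Subtype.val h))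
      · obtain ⟨j, _, rfl⟩ := Finset.mem_image.mp hbt
        exact Derivation.map_algebraMap _ _
    · obtain ⟨j, _, rfl⟩ := Finset.mem_image.mp hat
      have hns : algebraMap k F (β j) ∉ s := hβs j
      have hex : ∃ l, algebraMap k F (β l) = algebraMap k F (β j) := ⟨j, rfl⟩
      have hch : hex.choose = j := hβinj hex.choose_spec
      refine ⟨?_, fun b hb hba => ?_⟩
      · simp only [δ, dif_neg hns, dif_pos hex]
        rw [hch]; exact hΔ1 j
      · simp only [δ, dif_neg hns, dif_pos hex]
        rw [hch]
        rcases Finset.mem_union.mp hb with hbs | hbt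
        · exact hΔs j ⟨b, hbs⟩
        · obtain ⟨l, _, rfl⟩ := Finset.mem_image.mp hbt
          exact hΔ0 j l (fun h => hba (by rw [h]))
  have hPI := isPIndependent_of_dual p t δ hδ
  -- ### `F = F^p(t)`
  have htop' : adjoin Fp (t : Set F) = ⊤ := by
    rw [eq_top_iff]
    intro x _
    have hx : x ∈ (adjoin k (s : Set F)).toSubfield := by rw [htop]; trivial
    rw [adjoin_toSubfield] at hx
    have hsub : Set.range (algebraMap k F) ∪ (s : Set F) ⊆ ((adjoin Fp (t : Set F)).toSubfield : Set F) := by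
      rintro z (⟨c, rfl⟩ | hz)
      · obtain ⟨d, hd⟩ := hβspan c
        rw [hd, map_sum]
        refine sum_mem fun e _ => ?_
        rw [map_mul, map_pow]
        refine mul_mem ?_ ?_
        · exact (adjoin Fp (t : Set F)).algebraMap_mem ⟨_, RingHom.mem_fieldRange.mpr ⟨algebraMap k F (d e), frobenius_def ..⟩⟩
        · unfold pMonomial
          rw [map_prod]
          refine prod_mem fun i _ => ?_
          rw [map_pow]
          exact pow_mem (subset_adjoin Fp (t : Set F)
            (Finset.mem_coe.mpr (Finset.mem_union_right _ (Finset.mem_image.mpr ⟨i, Finset.mem_univ _, rfl⟩)))) _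
      · exact subset_adjoin Fp (t : Set F) (Finset.mem_coe.mpr (Finset.mem_union_left _ (Finset.mem_coe.mp hz)))
    exact Subfield.closure_le.mpr hsub hx
  have h1 := hPI.finrank_eq t subset_rfl
  rw [htop', finrank_top', hcard] at h1
  exact h1

end PurelyTranscendental


/-! ## §A The `p`-degree is invariant under finite extensions -/

/-- **`[K : K^p] = [F : F^p]` for a finite extension `K/F`** of fields of characteristic `p` (count `[K : F^p]` along `F^p ⊆ F ⊆ K` and
`F^p ⊆ K^p ⊆ K`; Frobenius gives `[K^p : F^p] = [K : F]`).  With the convention `finrank = 0` for infinite degree the identity holds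
verbatim (both sides vanish together). [cite: Matsumura1987, §26 Thm. 26.10] [folklore] -/
theorem finrank_frobenius_eq_of_finite {F K : Type} [Field F] [Field K] [Algebra F K] (p : ℕ) [Fact p.Prime]
    [CharP F p] [CharP K p] [Module.Finite F K] :
    finrank (frobenius K p).fieldRange K = finrank (frobenius F p).fieldRange F := by
  classical
  have hp : p.Prime := Fact.out
  set φ := algebraMap F K with hφdef
  have hφ : Function.Injective φ := φ.injective
  -- the subfields `K^p`, `F` (image) and `F^p` (image) of `K`
  set Kp : Subfield K := (frobenius K p).fieldRange with hKpdef
  set F₁ : Subfield K := φ.fieldRange with hF₁def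
  set F₀ : Subfield K := (φ.comp (frobenius F p)).fieldRange with hF₀def
  have hφp : ∀ x : F, φ (x ^ p) = frobenius K p (φ x) := fun x => by rw [map_pow, frobenius_def]
  have hF₀F₁ : F₀ ≤ F₁ := by
    rintro z hz
    obtain ⟨x, rfl⟩ := RingHom.mem_fieldRange.mp hz
    exact RingHom.mem_fieldRange.mpr ⟨x ^ p, by rw [RingHom.comp_apply, frobenius_def]⟩
  have hF₀Kp : F₀ ≤ Kp := by
    rintro z hz
    obtain ⟨x, rfl⟩ := RingHom.mem_fieldRange.mp hz
    exact RingHom.mem_fieldRange.mpr ⟨φ x, by rw [RingHom.comp_apply, frobenius_def, frobenius_def, map_pow]⟩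
  -- everything over the base field `B := F^p ⊆ K`
  let F₁' : IntermediateField F₀ K := F₁.toIntermediateField fun x => hF₀F₁ x.2
  let Kp' : IntermediateField F₀ K := Kp.toIntermediateField fun x => hF₀Kp x.2
  have htower₁ := Module.finrank_mul_finrank F₀ F₁' K
  have htower₂ := Module.finrank_mul_finrank F₀ Kp' K
  -- (T1) `[K : F] = [K : F₁']`
  let i₁ : F →+* F₁' := φ.codRestrict F₁' fun x => RingHom.mem_fieldRange.mpr ⟨x, rfl⟩
  have hi₁ : Function.Bijective i₁ := by
    refine ⟨fun a b h => hφ (congrArg Subtype.val h), fun y => ?_⟩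
    obtain ⟨x, hx⟩ := RingHom.mem_fieldRange.mp (show (y : K) ∈ F₁ from y.2)
    exact ⟨x, Subtype.ext hx⟩
  let e₁ : F ≃+* F₁' := RingEquiv.ofBijective i₁ hi₁
  have hT1 : finrank F K = finrank F₁' K := by
    refine Algebra.finrank_eq_of_equiv_equiv e₁ (RingEquiv.refl K) ?_
    ext x
    rfl
  -- (T3) `[F : F^p] = [F₁' : F₀]`
  let i₀ : (frobenius F p).fieldRange →+* F₀ := (φ.comp (Subfield.subtype _)).codRestrict F₀ fun x => by
    obtain ⟨y, hy⟩ := RingHom.mem_fieldRange.mp x.2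
    exact RingHom.mem_fieldRange.mpr ⟨y, by rw [RingHom.comp_apply, RingHom.comp_apply, hy]; rfl⟩
  have hi₀ : Function.Bijective i₀ := by
    refine ⟨fun a b h => Subtype.ext (hφ (congrArg Subtype.val h)), fun z => ?_⟩
    obtain ⟨y, hy⟩ := RingHom.mem_fieldRange.mp z.2
    refine ⟨⟨frobenius F p y, RingHom.mem_fieldRange.mpr ⟨y, rfl⟩⟩, Subtype.ext ?_⟩
    rw [← hy]; rfl
  let e₀ : (frobenius F p).fieldRange ≃+* F₀ := RingEquiv.ofBijective i₀ hi₀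
  have hT3 : finrank (frobenius F p).fieldRange F = finrank F₀ F₁' := by
    refine Algebra.finrank_eq_of_equiv_equiv e₀ e₁ ?_
    ext x
    rfl
  -- (T4) `[K^p : F^p] = [K : F]` (Frobenius)
  let iφ : F →+* F₀ := (φ.comp (frobenius F p)).codRestrict F₀ fun x => RingHom.mem_fieldRange.mpr ⟨x, rfl⟩
  have hiφ : Function.Bijective iφ := by
    refine ⟨fun a b h => frobenius_inj F p (hφ (congrArg Subtype.val h)), fun z => ?_⟩
    obtain ⟨x, hx⟩ := RingHom.mem_fieldRange.mp z.2
    exact ⟨x, Subtype.ext hx⟩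
  let eφ : F ≃+* F₀ := RingEquiv.ofBijective iφ hiφ
  let jφ : K →+* Kp' := (frobenius K p).codRestrict Kp' fun x => RingHom.mem_fieldRange.mpr ⟨x, rfl⟩
  have hjφ : Function.Bijective jφ := by
    refine ⟨fun a b h => frobenius_inj K p (congrArg Subtype.val h), fun z => ?_⟩
    obtain ⟨x, hx⟩ := RingHom.mem_fieldRange.mp (show (z : K) ∈ Kp from z.2)
    exact ⟨x, Subtype.ext hx⟩
  let fφ : K ≃+* Kp' := RingEquiv.ofBijective jφ hjφ
  have hT4 : finrank F K = finrank F₀ Kp' := by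
    refine Algebra.finrank_eq_of_equiv_equiv eφ fφ ?_
    ext x
    show φ (frobenius F p x) = frobenius K p (φ x)
    rw [frobenius_def, hφp]
  -- (T2) `[K : K^p] = [K : Kp']` and the count
  have hT2 : finrank Kp K = finrank Kp' K := rfl
  have hn : 0 < finrank F K := finrank_pos
  rw [← hT4] at htower₂
  rw [← hT1] at htower₁
  rw [hT3, hT2]
  have h : finrank F₀ F₁' * finrank F K = finrank Kp' K * 1 * finrank F K := by
    rw [mul_one, htower₁, ← htower₂, mul_comm]
  rw [mul_one] at h
  exact Nat.eq_of_mul_eq_mul_right hn h.symm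

end Summit.ResolutionOfSingularities.ResolutionOfSingularities.Theorems.RadicialJungCleanModels.Lens5TFrame

end
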